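import Literature.Barriers.ValiantsHypothesis.RankLiftingBarrier
import Literature.Computability.AlgebraicComplexity.PolarizationIdentity
import HarnessLib

/-!
# GMOW 2019, Theorem 1.16 (forms) from Theorem 1.14 (tensors), by polarisation

Discharge route for the named fact `GMOW2019_thm116` of `RankLiftingBarrier.lean`:
`GMOW2019_thm116_of_thm114 : GMOW2019_thm114 → GMOW2019_thm116` with the explicit constant
`B_{d,k} = 2^d · k^d`.

The paper proves Theorem 1.16 by rerunning the argument of §5.2 with the total-degree grading
(§5.3, "quite messy" constant `B_{d,k}`). We instead REDUCE forms to tensors: a `T_k`-rank method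
`φ : P(n,d) → Ten(m,k)` on forms lifts to the `T_k`-rank method `φ̃ = φ ∘ π` on `Ten(n,d)`, where
`π(e_j) = x_{j 1} ⋯ x_{j d}` (`Fintype.linearCombination`). On rank-one tensors
`π(u₁ ⊗ ⋯ ⊗ u_d) = ℓ_{u₁} ⋯ ℓ_{u_d}` is a product of `d` linear forms
(`linearCombination_prod_X_rankOneTensor`), which by the polarisation identity
is a combination of `2^d` `d`-th powers of linear forms; hence `trk φ̃(s) ≤ 2^d · r` on simples
(`tensorRankD_map_prod_linearForm_le`, `PolarizationIdentity.lean`). Theorem 1.14 for `φ̃` gives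
`trk φ̃(T) ≤ k^d n^{⌊(k-1)d/k⌋} · 2^d r` for every tensor `T`, and every form `f` of degree `d` is
`π(T_f)` for the tensor of its coefficients placed at one word per monomial
(`exists_linearCombination_prod_X_eq`), so `trk φ(f) ≤ 2^d k^d · n^{⌊(k-1)d/k⌋} · r`.

## References

* [GargMakamOliveiraWigderson2019] A. Garg, V. Makam, R. Oliveira, A. Wigderson, *More barriers
  for rank methods, via a "numeric to symbolic" transfer*, FOCS 2019 (arXiv:1904.04299), Thm. 1.14,
  Thm. 1.16, Ex. 1.5, §5.3.
-/

noncomputable section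

namespace Literature.Barriers.ValiantsHypothesis

open Literature.Computability.AlgebraicComplexity MvPolynomial
open scoped BigOperators

variable {F : Type*} [Field F] {n d : ℕ}

/-! ### From tensors to forms: `π(e_j) = x_{j 1} ⋯ x_{j d}` -/

/-- The linear map `π : Ten(n,d) → P(n,d)`, `e_j ↦ x_{j(1)} ⋯ x_{j(d)}` (here
`Fintype.linearCombination F (j ↦ ∏_l x_{j l})`) sends rank-one tensors to products of linear
forms: `π(u₁ ⊗ ⋯ ⊗ u_d) = ℓ_{u₁} ⋯ ℓ_{u_d}`. [folklore] -/
theorem linearCombination_prod_X_rankOneTensor (u : Fin d → Fin n → F) :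
    (Fintype.linearCombination F fun j : Fin d → Fin n => ∏ l, (X (j l) : MvPolynomial (Fin n) F))
      (rankOneTensor u) = ∏ l, linearForm (u l) := by
  classical
  rw [Fintype.linearCombination_apply]
  simp only [linearForm, rankOneTensor_apply]
  rw [Fintype.prod_sum (fun l i => C (u l i) * (X i : MvPolynomial (Fin n) F))]
  refine Finset.sum_congr rfl fun j _ => ?_
  rw [Finset.prod_mul_distrib, ← map_prod C, smul_eq_C_mul]

/-- The monomial `x_{j(1)} ⋯ x_{j(d)}` of a word `j`. [folklore] -/
theorem prod_X_word_eq_monomial (j : Fin d → Fin n) :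
    ∏ l, (X (j l) : MvPolynomial (Fin n) F) = monomial (∑ l, Finsupp.single (j l) 1) 1 := by
  rw [monomial_sum_one]
  rfl

/-- Every exponent vector of degree `d` is the content of a word of length `d`. [folklore] -/
theorem exists_word_eq (e : Fin n →₀ ℕ) (he : e.degree = d) :
    ∃ j : Fin d → Fin n, ∑ l, Finsupp.single (j l) (1 : ℕ) = e := by
  classical
  induction d generalizing e with
  | zero =>
    refine ⟨Fin.elim0, ?_⟩
    rw [(Finsupp.degree_eq_zero_iff e).1 he]
    simp
  | succ d ih =>
    have hne : e ≠ 0 := by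
      intro h0
      rw [h0, map_zero] at he
      exact Nat.succ_ne_zero d he.symm
    obtain ⟨a, ha⟩ := Finsupp.support_nonempty_iff.2 hne
    have hle : Finsupp.single a 1 ≤ e :=
      Finsupp.single_le_iff.2 (Nat.one_le_iff_ne_zero.2 (Finsupp.mem_support_iff.1 ha))
    have hsplit : e - Finsupp.single a 1 + Finsupp.single a 1 = e := tsub_add_cancel_of_le hle
    have hdeg : (e - Finsupp.single a 1).degree = d := by
      have := congrArg Finsupp.degree hsplit
      rw [map_add, Finsupp.degree_single, he] at this
      omega
    obtain ⟨j, hj⟩ := ih (e - Finsupp.single a 1) hdeg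
    refine ⟨Fin.cons a j, ?_⟩
    rw [Fin.sum_univ_succ, Fin.cons_zero]
    simp only [Fin.cons_succ]
    rw [hj, add_comm, hsplit]

/-- **Every form of degree `d` comes from a tensor**: `f = π(T_f)` with `T_f` the coefficients of
`f` placed at one word per monomial. [folklore] -/
theorem exists_linearCombination_prod_X_eq {f : MvPolynomial (Fin n) F} (hf : f.IsHomogeneous d) :
    ∃ T : (Fin d → Fin n) → F,
      (Fintype.linearCombination F fun j : Fin d → Fin n =>
        ∏ l, (X (j l) : MvPolynomial (Fin n) F)) T = f := by
  classical
  -- one word per exponent vector of degree `d`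
  have hword : ∀ e ∈ f.support, ∃ j : Fin d → Fin n, ∑ l, Finsupp.single (j l) (1 : ℕ) = e := by
    intro e he
    refine exists_word_eq e ?_
    by_contra hdeg
    exact (mem_support_iff.1 he) (hf.coeff_eq_zero hdeg)
  choose J hJ using hword
  refine ⟨∑ e ∈ f.support.attach, coeff e.1 f • Pi.single (J e.1 e.2) (1 : F), ?_⟩
  rw [map_sum]
  conv_rhs => rw [← support_sum_monomial_coeff f, ← Finset.sum_attach]
  refine Finset.sum_congr rfl fun e _ => ?_
  rw [map_smul, Fintype.linearCombination_apply_single, one_smul, prod_X_word_eq_monomial,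
    hJ e.1 e.2, smul_monomial, smul_eq_mul, mul_one]

/-! ### Theorem 1.16 from Theorem 1.14 -/

/-- **Garg–Makam–Oliveira–Wigderson 2019, Theorem 1.16 from Theorem 1.14** (by polarisation,
constant `B_{d,k} = 2^d · k^d`): for a `T_k`-rank method `φ : P(n,d) → Ten(m,k)` with
`trk φ(ℓ^d) ≤ r` on powers of linear forms, the lift `φ ∘ π` is a `T_k`-rank method on `Ten(n,d)`
with `trk ≤ 2^d r` on rank-one tensors, so Theorem 1.14 bounds `trk φ(f) = trk (φ ∘ π)(T_f)` by
`k^d n^{⌊(k-1)d/k⌋} · 2^d r` for every form `f` of degree `d`.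
[cite: GargMakamOliveiraWigderson2019, Thm. 1.16] -/
theorem GMOW2019_thm116_of_thm114 (h : GMOW2019_thm114) : GMOW2019_thm116 := by
  intro d k hk
  refine ⟨2 ^ d * k ^ d, ?_⟩
  intro F _ _ _ n m φ r hr f hf
  classical
  haveI : NeZero k := ⟨by omega⟩
  have hsimple : ∀ u : Fin d → Fin n → F,
      tensorRankD ((φ ∘ₗ Fintype.linearCombination F fun j : Fin d → Fin n =>
        ∏ l, (X (j l) : MvPolynomial (Fin n) F)) (rankOneTensor u)) ≤ 2 ^ d * r := fun u => by
    rw [LinearMap.comp_apply, linearCombination_prod_X_rankOneTensor]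
    exact tensorRankD_map_prod_linearForm_le φ hr u
  obtain ⟨T, hT⟩ := exists_linearCombination_prod_X_eq hf
  have hbound := h F n d m k hk (φ ∘ₗ Fintype.linearCombination F fun j : Fin d → Fin n =>
    ∏ l, (X (j l) : MvPolynomial (Fin n) F)) (2 ^ d * r) hsimple T
  rw [LinearMap.comp_apply, hT] at hbound
  calc tensorRankD (φ f) ≤ k ^ d * n ^ ((k - 1) * d / k) * (2 ^ d * r) := hbound
    _ = 2 ^ d * k ^ d * n ^ ((k - 1) * d / k) * r := by ring

end Literature.Barriers.ValiantsHypothesis
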